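import Summits.KontsevichZagierPeriods.KontsevichZagierPeriods.Theorems.CompleteModGammaSector.Negative.LoadBearing

/-!
# `CompleteModGammaSector` (stmt-KontsevichZagierPeriods-14233) — negative side: admissible
subgroups (`PairHyp`), the two models `⊤` and `ker eval`, and the remaining hypothesis analysis

Complements `Negative/LoadBearing.lean` (§§0–3 of the crux work file, landed by the sibling
disprover seat) with the vocabulary the later negative files use (cdisprove gen 1, this seat's
`Cruxes/CompleteModGammaSector/Disproof.lean`):

* `PairHyp H` — the second hypothesis of the crux verbatim, `pairHyp_iff_closure_le :
  PairHyp H ↔ closure gammaHodgePairs ≤ H`; `sector_le_of_admissible` (`sector` is the least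
  admissible `H`), `completeModGammaSector_iff_forall`, `completeModGammaSector_iff_sector`;
* `admissible_top`, `admissible_ker_eval`, `crux_at_ker_eval` — the `H`-interface is inhabited by
  junk (`⊤`) and by the genuine proper model `ker eval`, at which the conclusion holds outright; so
  all content sits at `H = sector`; `completeModGammaSector_iff_ker_eq` (`ker eval = sector`);
* `completeModGammaSectorWithoutPairs_iff_summit` — dropping the pair hypothesis gives EXACTLY the
  summit (nothing to refute there short of Conjecture 1); `CompleteModGammaSectorWithoutRelationsLe`
  (refuted in `Negative/NewtonLeibniz.lean`).
-/

noncomputable section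

open MeasureTheory Set
open scoped BigOperators

namespace Summit.KontsevichZagierPeriods.CompleteModGammaSectorNegative

open Literature.NumberTheory.Transcendental
open Literature.NumberTheory.Transcendental.KZ
open Summit.KontsevichZagierPeriods.KontsevichZagierPeriods.Theses.TerasomaMultiplication
  (CompleteModGammaSector GammaHodgeSector closes)

/-- A subgroup satisfies the PAIR HYPOTHESIS of the crux (its second hypothesis, verbatim). -/
def PairHyp (H : AddSubgroup FormalRep) : Prop :=
  ∀ (N N' k : ℕ) (x y : Fin N → ℚ) (x' y' : Fin N' → ℚ) (c : ℝ),
    (∀ j, 0 < x j ∧ 0 < y j ∧ Int.fract (x j) ≠ 0 ∧ Int.fract (y j) ≠ 0) →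
    (∀ l, 0 < x' l ∧ 0 < y' l ∧ Int.fract (x' l) ≠ 0 ∧ Int.fract (y' l) ≠ 0) →
    (∀ u : ℕ, 0 < u → (∀ j, Nat.Coprime u (x j).den ∧ Nat.Coprime u (y j).den) →
      (∀ l, Nat.Coprime u (x' l).den ∧ Nat.Coprime u (y' l).den) →
      ((∑ j, (Int.fract ((u : ℚ) * x j) + Int.fract ((u : ℚ) * y j) -
          Int.fract ((u : ℚ) * (x j + y j)))) -
        ∑ l, (Int.fract ((u : ℚ) * x' l) + Int.fract ((u : ℚ) * y' l) -
          Int.fract ((u : ℚ) * (x' l + y' l)))) = (k : ℚ)) →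
    IsAlgebraic ℚ c →
    ∀ (ρ : IntegralRep N) (ρ' : IntegralRep (2 * k + N')),
      ρ.domain = {t | ∀ j, t j ∈ Set.Ioo (0:ℝ) 1} →
      Set.EqOn ρ.integrand (fun t => ∏ j, (t j) ^ ((x j : ℝ) - 1) * (1 - t j) ^ ((y j : ℝ) - 1))
        ρ.domain →
      ρ'.domain = {z | (∑ i : Fin (2 * k), (z (Fin.castAdd N' i)) ^ 2) < 1 ∧
        ∀ l : Fin N', z (Fin.natAdd (2 * k) l) ∈ Set.Ioo (0:ℝ) 1} →
      Set.EqOn ρ'.integrand (fun z => c * (k.factorial : ℝ) *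
        ∏ l, (z (Fin.natAdd (2 * k) l)) ^ ((x' l : ℝ) - 1) *
          (1 - z (Fin.natAdd (2 * k) l)) ^ ((y' l : ℝ) - 1)) ρ'.domain →
      ρ.value = ρ'.value → of ρ - of ρ' ∈ H

/-- The pair hypothesis says exactly `gammaHodgePairs ⊆ H`. [folklore] -/
theorem pairHyp_iff (H : AddSubgroup FormalRep) : PairHyp H ↔ gammaHodgePairs ⊆ (H : Set FormalRep) := by
  constructor
  · rintro h d ⟨N, N', k, x, y, x', y', c, ρ, ρ', hx, hx', hH, hc, hd, hi, hd', hi', hv, rfl⟩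
    exact h N N' k x y x' y' c hx hx' hH hc ρ ρ' hd hi hd' hi' hv
  · intro h N N' k x y x' y' c hx hx' hH hc ρ ρ' hd hi hd' hi' hv
    exact h ⟨N, N', k, x, y, x', y', c, ρ, ρ', hx, hx', hH, hc, hd, hi, hd', hi', hv, rfl⟩

/-- The pair hypothesis says exactly `closure gammaHodgePairs ≤ H`. [folklore] -/
theorem pairHyp_iff_closure_le (H : AddSubgroup FormalRep) :
    PairHyp H ↔ AddSubgroup.closure gammaHodgePairs ≤ H := by
  rw [pairHyp_iff, AddSubgroup.closure_le]

/-- The crux unfolded: the subgroup form, over `PairHyp` (definitional). [folklore] -/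
theorem completeModGammaSector_iff_forall :
    CompleteModGammaSector ↔ ∀ H : AddSubgroup FormalRep, relations ≤ H → PairHyp H →
      ∀ ⦃n m : ℕ⦄ (r : IntegralRep n) (r' : IntegralRep m),
        r.IsRational → r'.IsRational → r.value = r'.value → of r - of r' ∈ H :=
  Iff.rfl

/-- `sector` is admissible: it contains the moves. [folklore] -/
theorem relations_le_sector : relations ≤ sector := le_sup_left

/-- `sector` is admissible: it satisfies the pair hypothesis. [folklore] -/
theorem pairHyp_sector : PairHyp sector :=
  (pairHyp_iff_closure_le _).mpr le_sup_right

/-- `sector` is the SMALLEST admissible subgroup. [folklore] -/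
theorem sector_le_of_admissible {H : AddSubgroup FormalRep} (h₁ : relations ≤ H) (h₂ : PairHyp H) :
    sector ≤ H :=
  sup_le h₁ ((pairHyp_iff_closure_le H).mp h₂)

/-- Subgroup form = sup form, with the sup form unfolded (`SectorForm`). [folklore] -/
theorem completeModGammaSector_iff_sector :
    CompleteModGammaSector ↔ ∀ ⦃n m : ℕ⦄ (r : IntegralRep n) (r' : IntegralRep m),
      r.IsRational → r'.IsRational → r.value = r'.value → of r - of r' ∈ sector :=
  completeModGammaSector_iff_sectorForm

/-- The sibling crux `GammaHodgeSector` says exactly that `relations` itself satisfies the pair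
hypothesis (definitional). [folklore] -/
theorem gammaHodgeSector_iff_pairHyp_relations : GammaHodgeSector ↔ PairHyp relations :=
  Iff.rfl

/-- NON-VACUITY OF THE INTERFACE: the hypotheses on `H` are satisfiable — by `⊤` (junk) … -/
theorem admissible_top : relations ≤ (⊤ : AddSubgroup FormalRep) ∧ PairHyp ⊤ :=
  ⟨le_top, fun _ _ _ _ _ _ _ _ _ _ _ _ _ _ _ _ _ _ _ => AddSubgroup.mem_top _⟩

/-- … and by the PROPER subgroup `ker eval` (a genuine model: soundness of the moves plus the value
conjunct of every pair). [cite: KontsevichZagier2001, §1.2] -/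
theorem admissible_ker_eval : relations ≤ eval.ker ∧ PairHyp eval.ker :=
  ⟨relations_le_ker_eval_holds,
    (pairHyp_iff_closure_le _).mpr closure_gammaHodgePairs_le_ker_eval⟩

/-- The instance `H = ker eval` of the crux is TRUE (trivially, by `hv`): the content of the crux
sits entirely at the least admissible subgroup `sector`. [folklore] -/
theorem crux_at_ker_eval ⦃n m : ℕ⦄ (r : IntegralRep n) (r' : IntegralRep m) (hv : r.value = r'.value) :
    of r - of r' ∈ eval.ker := by
  show eval (of r - of r') = 0
  rw [eval_of_sub_of, hv, sub_self]

/-- The crux says `ker eval = sector`. [folklore] -/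
theorem completeModGammaSector_iff_ker_eq : CompleteModGammaSector ↔ eval.ker = sector := by
  rw [completeModGammaSector_iff_ker_le]
  exact ⟨fun h => le_antisymm h sector_le_ker_eval, fun h => h.le⟩

/-- The crux with the hypothesis `relations ≤ H` DROPPED (negative knowledge; refuted in
`Negative/NewtonLeibniz.lean`). -/
def CompleteModGammaSectorWithoutRelationsLe : Prop :=
  ∀ H : AddSubgroup FormalRep, PairHyp H →
    ∀ ⦃n m : ℕ⦄ (r : IntegralRep n) (r' : IntegralRep m),
      r.IsRational → r'.IsRational → r.value = r'.value → of r - of r' ∈ H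

/-- The crux with the PAIR HYPOTHESIS DROPPED (negative knowledge). -/
def CompleteModGammaSectorWithoutPairs : Prop :=
  ∀ H : AddSubgroup FormalRep, relations ≤ H →
    ∀ ⦃n m : ℕ⦄ (r : IntegralRep n) (r' : IntegralRep m),
      r.IsRational → r'.IsRational → r.value = r'.value → of r - of r' ∈ H

/-- **Dropping the pair hypothesis gives EXACTLY the summit** (take `H = relations`; conversely
monotonicity): the Γ-pairs are the only thing separating the crux from Conjecture 1 itself, so
there is nothing to refute here short of the summit — and, dually, every STRENGTHENING of the pair
family (fewer pairs, down to none) stays summit-implied. [cite: KontsevichZagier2001, §1.2 Conjecture 1] -/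
theorem completeModGammaSectorWithoutPairs_iff_summit :
    CompleteModGammaSectorWithoutPairs ↔ KontsevichZagierPeriods :=
  ⟨fun h _ _ r r' hr hr' hv => h relations le_rfl r r' hr hr' hv,
    fun h _ hH _ _ r r' hr hr' hv => hH (h r r' hr hr' hv)⟩

/-- The H-quantified form of "value equality is load-bearing" (cf. `completeModGammaSector_false_without_valueEq`
for the sector form): at the admissible `H = ker eval`, `[pt, 1]` and `[pt, 2]` are separated. [folklore] -/
theorem completeModGammaSector_false_without_valueEq_forall :
    ¬ ∀ H : AddSubgroup FormalRep, relations ≤ H → PairHyp H →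
      ∀ ⦃n m : ℕ⦄ (r : IntegralRep n) (r' : IntegralRep m), r.IsRational → r'.IsRational →
        of r - of r' ∈ H := by
  intro h
  have h0 : eval (of (Literature.Barriers.KontsevichZagierPeriods.KZ.constRep 1) -
      of (Literature.Barriers.KontsevichZagierPeriods.KZ.constRep 2)) = 0 :=
    h _ admissible_ker_eval.1 admissible_ker_eval.2 _ _
      (Literature.Barriers.KontsevichZagierPeriods.KZ.constRep_isRational 1)
      (Literature.Barriers.KontsevichZagierPeriods.KZ.constRep_isRational 2)
  rw [eval_of_sub_of, Literature.Barriers.KontsevichZagierPeriods.KZ.constRep_value,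
    Literature.Barriers.KontsevichZagierPeriods.KZ.constRep_value] at h0
  norm_num at h0

end Summit.KontsevichZagierPeriods.CompleteModGammaSectorNegative
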